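import Summits.CriticalPhenomena.SAWScalingLimit.Theses.SAWCompassLattice
import Summits.CriticalPhenomena.SAWScalingLimit.Theorems.SAWDevelopingMapHexTransferCompassEndpointsFaceChains
import Literature.Probability.RandomPlanarGeometry.SAWScalingLimitFamily
import Literature.Probability.LatticeModels.MeshDomainBulk

/-!
# `CompassEndpoints` (route SAWCompassLattice, item stmt-CriticalPhenomena-6968)

Stub `stub_compassEndpoints` of the line `Sketch` for the crux
`Summit.CriticalPhenomena.SAWScalingLimit.Theses.SAWPhaseRetrieval.HexTransfer`
(stmt-CriticalPhenomena-14221): **every Dobrushin domain `D = (Ω; a, b)` admits port (mid-edge)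
endpoint approximations on Glazman–Manolescu's square tiling `Θ ≡ π/2`**
(`IsYBEndpointApprox (fun _ => π/2) D a_δ b_δ`: for all small `δ > 0` a Yang–Baxter walk of
`Ω_δ = meshFaces (π/2) Ω δ` joins `a_δ` to `b_δ`, and `δ · a_δ → a`, `δ · b_δ → b`).

Proof (the `δℤ²` template is
`Literature.Probability.RandomPlanarGeometry.SAW.exists_isEndpointApprox`). Everything below is
stated for an angle sequence `Θ` all of whose side vectors are `1` (`∀ k, colShift Θ k = 1`),
which is the case of `Θ ≡ π/2` (`colShift_sq`); the face of a point `u` (lattice coordinates) is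
`(⌊Re u⌋, ⌊Im u + 1/2⌋)`, and the adjacency graph of the faces of a set `S` (two distinct faces
sharing a side, both in `S`) is written out with `SimpleGraph.fromRel` exactly as in the
registered sub-goal `stub_compassEndpoints_faceChains` (helper file `…CompassEndpointsFaceChains`).
* geometry: `colOffset Θ k = k`, so the face `(k, j)` is the closed unit square with lower-left
  corner `k + (j - 1/2) i` (`planeCorner_eq`), inside the closed disc of radius `2` about that
  corner, and the corner of the face of `u` is within `2` of `u`; hence a face whose corner is
  within `3` of `z/δ` lies in `Ω_δ` as soon as the disc of radius `5δ` about `z` lies in `Ω`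
  (`mem_meshFaces_of_dist_lt`);
* local step: if moreover `|w - z| < δ`, the faces of `z/δ` and `w/δ` differ by at most one unit
  in each coordinate and are joined inside `Ω_δ` by an L-shaped chain of at most two steps
  (`reachable_of_dist_lt`);
* bulk: two points of `Ω` lie in an open preconnected `V ⊆ Ω` at distance `> ρ` from `Ωᶜ`
  (`exists_isOpen_isPreconnected_bulk`), on which the `Ω_δ`-component of the face of `w/δ` is a
  locally constant function of `w`, hence constant (`IsPreconnected.constant`, `reachable_of_mem`);
  so for `5δ ≤ ρ` the sub-goal `stub_compassEndpoints_faceChains` yields a Yang–Baxter walk of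
  `Ω_δ` from a side of the face of the first point to a side of the face of the second
  (`exists_threshold`);
* assembly: interior points `z_n → a`, `w_n → b`, stage thresholds `ε n`, and the diagonal stage
  selection `exists_stage_tendsto_atTop` (`n = N δ → ∞` along `δ → 0⁺`); the chosen endpoints
  are sides of the faces of `z_{N δ}/δ`, `w_{N δ}/δ`, within `4δ` of `z_{N δ}`, `w_{N δ}` after
  rescaling (`dist_mul_planeMidpoint_le`), whence the two limits (`tendsto_of_dist_le`).
-/

noncomputable section

open Literature.Probability.RandomPlanarGeometry
open Literature.Probability.RandomPlanarGeometry.SAW.YangBaxter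
open Filter Topology Metric
open Complex (I)
open Summit.CriticalPhenomena.SAWScalingLimit.Theses

namespace Summit.CriticalPhenomena.SAWScalingLimit.Cruxes.HexTransfer.Sketch

namespace Endpoints

variable {Θ : ℤ → ℝ}

/-! ### Geometry of a tiling with unit side vectors (the square tiling `Θ ≡ π/2`) -/

/-- On the square tiling every column has side vector `1`. [folklore] -/
theorem colShift_sq (k : ℤ) : colShift (fun (_ : ℤ) => Real.pi / 2) k = 1 := by
  simp [colShift]

/-- If all side vectors are `1`, column `k` starts at abscissa `k`. [folklore] -/
theorem colOffset_eq (hΘ : ∀ k, colShift Θ k = 1) (k : ℤ) : colOffset Θ k = k := by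
  induction k using Int.induction_on with
  | zero => simp
  | succ n ih =>
    rw [colOffset_add_one, ih, hΘ]
    push_cast
    ring
  | pred n ih =>
    have h := colOffset_add_one Θ (-(n : ℤ) - 1)
    rw [sub_add_cancel, ih, hΘ] at h
    push_cast at h ⊢
    linear_combination (-1 : ℂ) * h

/-- If all side vectors are `1`, the lower-left corner of the face `(k, j)` is `k + (j - 1/2) i`.
[folklore] -/
theorem planeCorner_eq (hΘ : ∀ k, colShift Θ k = 1) (k j : ℤ) :
    planeCorner Θ (k, j) = (k : ℂ) + ((j : ℂ) - 1 / 2) * I := by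
  rw [planeCorner, colOffset_eq hΘ]
  ring

/-- If all side vectors are `1`, the closed face (a unit square) lies in the closed disc of
radius `2` about its lower-left corner. [folklore] -/
theorem rhombus_subset_closedBall (hΘ : ∀ k, colShift Θ k = 1) (f : Face) :
    rhombus Θ f ⊆ closedBall (planeCorner Θ f) 2 := by
  refine convexHull_min ?_ (convex_closedBall _ _)
  intro x hx
  simp only [cornerSet, Set.mem_insert_iff, Set.mem_singleton_iff] at hx
  rw [mem_closedBall, dist_eq_norm]
  rcases hx with rfl | rfl | rfl | rfl
  · simp
  · simp
  · simp [hΘ]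
  · rw [hΘ]
    calc ‖planeCorner Θ f + I + 1 - planeCorner Θ f‖ = ‖I + 1‖ := by ring_nf
      _ ≤ ‖I‖ + ‖(1 : ℂ)‖ := norm_add_le _ _
      _ = 2 := by norm_num

/-- If all side vectors are `1`, the lower-left corner of the face `(⌊Re u⌋, ⌊Im u + 1/2⌋)` of a
point `u` is within distance `2` of `u`. [folklore] -/
theorem dist_planeCorner_floor_lt (hΘ : ∀ k, colShift Θ k = 1) (u : ℂ) :
    dist (planeCorner Θ (⌊u.re⌋, ⌊u.im + 1 / 2⌋)) u < 2 := by
  rw [planeCorner_eq hΘ, dist_eq_norm]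
  refine (Complex.norm_le_abs_re_add_abs_im _).trans_lt ?_
  have hre : ((⌊u.re⌋ : ℂ) + ((⌊u.im + 1 / 2⌋ : ℂ) - 1 / 2) * I - u).re = (⌊u.re⌋ : ℝ) - u.re := by
    simp
  have him : ((⌊u.re⌋ : ℂ) + ((⌊u.im + 1 / 2⌋ : ℂ) - 1 / 2) * I - u).im =
      (⌊u.im + 1 / 2⌋ : ℝ) - 1 / 2 - u.im := by
    simp
  rw [hre, him]
  have h1 : |(⌊u.re⌋ : ℝ) - u.re| ≤ 1 := by
    rw [abs_le]
    constructor <;> linarith [Int.floor_le u.re, Int.lt_floor_add_one u.re]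
  have h2 : |(⌊u.im + 1 / 2⌋ : ℝ) - 1 / 2 - u.im| < 1 := by
    rw [abs_lt]
    constructor <;> linarith [Int.floor_le (u.im + 1 / 2), Int.lt_floor_add_one (u.im + 1 / 2)]
  linarith

/-- Rescaling: `|δ x - z| = δ |x - z/δ|` for `δ > 0`. [folklore] -/
theorem norm_mul_sub_eq {δ : ℝ} (hδ : 0 < δ) (x z : ℂ) :
    ‖(δ : ℂ) * x - z‖ = δ * ‖x - z / δ‖ := by
  have hδ' : (δ : ℂ) ≠ 0 := Complex.ofReal_ne_zero.2 hδ.ne'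
  rw [show (δ : ℂ) * x - z = (δ : ℂ) * (x - z / δ) by rw [mul_sub, mul_div_cancel₀ _ hδ'],
    norm_mul, Complex.norm_real, Real.norm_of_nonneg hδ.le]

/-- **Faces near an interior point belong to `Ω_δ`**: if the disc of radius `ρ ≥ 5δ` about `z`
lies in `Ω`, every face whose corner is within `3` of `z/δ` lies in `meshFaces Θ Ω δ` (its
closed square is within `5δ` of `z` after rescaling). [folklore] -/
theorem mem_meshFaces_of_dist_lt (hΘ : ∀ k, colShift Θ k = 1) {Ω : Set ℂ} {δ ρ : ℝ} (hδ : 0 < δ)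
    (hδρ : 5 * δ ≤ ρ) {z : ℂ} (hz : ball z ρ ⊆ Ω) {f : Face}
    (hf : dist (planeCorner Θ f) (z / δ) < 3) : f ∈ meshFaces Θ Ω δ := by
  intro x hx
  apply hz
  have h1 : dist x (planeCorner Θ f) ≤ 2 := rhombus_subset_closedBall hΘ f hx
  have h2 : dist x (z / δ) < 5 := by linarith [dist_triangle x (planeCorner Θ f) (z / δ)]
  rw [mem_ball, dist_eq_norm, norm_mul_sub_eq hδ, ← dist_eq_norm]
  nlinarith

/-! ### Joining the faces of nearby points inside `Ω_δ` -/

/-- Reals at distance `< 1` have integer parts differing by at most one. [folklore] -/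
theorem floor_eq_or_of_abs_sub_lt_one {x y : ℝ} (h : |y - x| < 1) :
    ⌊y⌋ = ⌊x⌋ ∨ ⌊y⌋ = ⌊x⌋ + 1 ∨ ⌊x⌋ = ⌊y⌋ + 1 := by
  have h₁ : ⌊y⌋ < ⌊x⌋ + 2 := Int.floor_lt.2 (by
    push_cast
    linarith [Int.lt_floor_add_one x, (abs_lt.1 h).2])
  have h₂ : ⌊x⌋ < ⌊y⌋ + 2 := Int.floor_lt.2 (by
    push_cast
    linarith [Int.lt_floor_add_one y, (abs_lt.1 h).1])
  omega

/-- Faces of one row whose columns differ by at most one are joined in the adjacency graph of the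
faces of `S` when both lie in `S`. [folklore] -/
theorem reachable_of_fst {S : Set Face} {k k' : ℤ} (j : ℤ) (hk : k' = k ∨ k' = k + 1 ∨ k = k' + 1)
    (h : (k, j) ∈ S) (h' : (k', j) ∈ S) :
    (SimpleGraph.fromRel fun f g : Face =>
      (∃ e : MidEdge, (∃ s, f.side s = e) ∧ ∃ t, g.side t = e) ∧ f ∈ S ∧ g ∈ S).Reachable
      (k, j) (k', j) := by
  have hadj : ∀ k : ℤ, ∃ e : MidEdge, (∃ s, Face.side (k, j) s = e) ∧
      ∃ t, Face.side (k + 1, j) t = e := fun k => ⟨.vert (k + 1) j, ⟨.E, rfl⟩, ⟨.W, rfl⟩⟩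
  rcases hk with rfl | rfl | rfl
  · rfl
  · exact ((SimpleGraph.fromRel_adj _ _ _).2
      ⟨fun e => by simp at e, Or.inl ⟨hadj k, h, h'⟩⟩).reachable
  · exact ((SimpleGraph.fromRel_adj _ _ _).2
      ⟨fun e => by simp at e, Or.inr ⟨hadj k', h', h⟩⟩).reachable

/-- Faces of one column whose rows differ by at most one are joined in the adjacency graph of the
faces of `S` when both lie in `S`. [folklore] -/
theorem reachable_of_snd {S : Set Face} (k : ℤ) {j j' : ℤ} (hj : j' = j ∨ j' = j + 1 ∨ j = j' + 1)
    (h : (k, j) ∈ S) (h' : (k, j') ∈ S) :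
    (SimpleGraph.fromRel fun f g : Face =>
      (∃ e : MidEdge, (∃ s, f.side s = e) ∧ ∃ t, g.side t = e) ∧ f ∈ S ∧ g ∈ S).Reachable
      (k, j) (k, j') := by
  have hadj : ∀ j : ℤ, ∃ e : MidEdge, (∃ s, Face.side (k, j) s = e) ∧
      ∃ t, Face.side (k, j + 1) t = e := fun j => ⟨.slant k (j + 1), ⟨.N, rfl⟩, ⟨.S, rfl⟩⟩
  rcases hj with rfl | rfl | rfl
  · rfl
  · exact ((SimpleGraph.fromRel_adj _ _ _).2
      ⟨fun e => by simp at e, Or.inl ⟨hadj j, h, h'⟩⟩).reachable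
  · exact ((SimpleGraph.fromRel_adj _ _ _).2
      ⟨fun e => by simp at e, Or.inr ⟨hadj j', h', h⟩⟩).reachable

/-- **Local step.** If the disc of radius `ρ ≥ 5δ` about `z` lies in `Ω` and `|w - z| < δ`, the
faces of `z/δ` and `w/δ` are joined inside `Ω_δ` (by an L-shaped chain of at most two steps).
[folklore] -/
theorem reachable_of_dist_lt (hΘ : ∀ k, colShift Θ k = 1) {Ω : Set ℂ} {δ ρ : ℝ} (hδ : 0 < δ)
    (hδρ : 5 * δ ≤ ρ) {z w : ℂ} (hz : ball z ρ ⊆ Ω) (hw : dist w z < δ) :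
    (SimpleGraph.fromRel fun f g : Face =>
      (∃ e : MidEdge, (∃ s, f.side s = e) ∧ ∃ t, g.side t = e) ∧
        f ∈ meshFaces Θ Ω δ ∧ g ∈ meshFaces Θ Ω δ).Reachable
      (⌊(z / δ).re⌋, ⌊(z / δ).im + 1 / 2⌋) (⌊(w / δ).re⌋, ⌊(w / δ).im + 1 / 2⌋) := by
  have hd : dist (w / δ) (z / δ) < 1 := by
    rw [dist_eq_norm, ← sub_div, norm_div, Complex.norm_real, Real.norm_of_nonneg hδ.le,
      div_lt_one hδ, ← dist_eq_norm]
    exact hw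
  have hre : |(w / δ).re - (z / δ).re| < 1 := by
    rw [← Complex.sub_re]
    exact (Complex.abs_re_le_norm _).trans_lt (by rwa [← dist_eq_norm])
  have him : |((w / δ).im + 1 / 2) - ((z / δ).im + 1 / 2)| < 1 := by
    rw [add_sub_add_right_eq_sub, ← Complex.sub_im]
    exact (Complex.abs_im_le_norm _).trans_lt (by rwa [← dist_eq_norm])
  have hcz := dist_planeCorner_floor_lt hΘ (z / δ)
  have hcw := dist_planeCorner_floor_lt hΘ (w / δ)
  set k := ⌊(z / δ).re⌋
  set j := ⌊(z / δ).im + 1 / 2⌋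
  set k' := ⌊(w / δ).re⌋
  set j' := ⌊(w / δ).im + 1 / 2⌋
  have hk : k' = k ∨ k' = k + 1 ∨ k = k' + 1 := floor_eq_or_of_abs_sub_lt_one hre
  have hj : j' = j ∨ j' = j + 1 ∨ j = j' + 1 := floor_eq_or_of_abs_sub_lt_one him
  -- the three faces `(k, j)`, `(k', j)`, `(k', j')` lie in `Ω_δ`
  have hA : (k, j) ∈ meshFaces Θ Ω δ :=
    mem_meshFaces_of_dist_lt hΘ hδ hδρ hz (hcz.trans (by norm_num))
  have hB : (k', j) ∈ meshFaces Θ Ω δ := by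
    refine mem_meshFaces_of_dist_lt hΘ hδ hδρ hz ?_
    have h1 : dist (planeCorner Θ (k', j)) (planeCorner Θ (k, j)) ≤ 1 := by
      rw [planeCorner_eq hΘ, planeCorner_eq hΘ, dist_eq_norm]
      rcases hk with h | h | h <;> simp [h]
    linarith [dist_triangle (planeCorner Θ (k', j)) (planeCorner Θ (k, j)) (z / δ)]
  have hC : (k', j') ∈ meshFaces Θ Ω δ := by
    refine mem_meshFaces_of_dist_lt hΘ hδ hδρ hz ?_
    linarith [dist_triangle (planeCorner Θ (k', j')) (w / δ) (z / δ)]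
  exact (reachable_of_fst j hk hA hB).trans (reachable_of_snd k' hj hB hC)

/-- **Faces of the bulk are joined in `Ω_δ`.** If `V` is preconnected and the disc of radius
`ρ ≥ 5δ` about each point of `V` lies in `Ω`, the faces of `z/δ` and `w/δ` are joined inside
`Ω_δ` for all `z, w ∈ V` (the `Ω_δ`-component of the face of `w/δ` is a locally constant function
of `w ∈ V`). [folklore] -/
theorem reachable_of_mem (hΘ : ∀ k, colShift Θ k = 1) {Ω V : Set ℂ} {δ ρ : ℝ}
    (hV : IsPreconnected V) (hVΩ : ∀ w ∈ V, ball w ρ ⊆ Ω) (hδ : 0 < δ) (hδρ : 5 * δ ≤ ρ)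
    {z w : ℂ} (hz : z ∈ V) (hw : w ∈ V) :
    (SimpleGraph.fromRel fun f g : Face =>
      (∃ e : MidEdge, (∃ s, f.side s = e) ∧ ∃ t, g.side t = e) ∧
        f ∈ meshFaces Θ Ω δ ∧ g ∈ meshFaces Θ Ω δ).Reachable
      (⌊(z / δ).re⌋, ⌊(z / δ).im + 1 / 2⌋) (⌊(w / δ).re⌋, ⌊(w / δ).im + 1 / 2⌋) := by
  set G := SimpleGraph.fromRel fun f g : Face =>
    (∃ e : MidEdge, (∃ s, f.side s = e) ∧ ∃ t, g.side t = e) ∧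
      f ∈ meshFaces Θ Ω δ ∧ g ∈ meshFaces Θ Ω δ
  letI : TopologicalSpace G.ConnectedComponent := ⊥
  haveI : DiscreteTopology G.ConnectedComponent := ⟨rfl⟩
  let φ : ℂ → G.ConnectedComponent := fun x =>
    G.connectedComponentMk (⌊(x / δ).re⌋, ⌊(x / δ).im + 1 / 2⌋)
  have key : ∀ x ∈ V, ∀ y, dist y x < δ → φ y = φ x := fun x hx y hy =>
    (SimpleGraph.ConnectedComponent.sound (reachable_of_dist_lt hΘ hδ hδρ (hVΩ x hx) hy)).symm
  have hcont : ContinuousOn φ V := by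
    intro x hx
    refine ContinuousAt.continuousWithinAt ((continuousAt_const (y := φ x)).congr ?_)
    filter_upwards [ball_mem_nhds x hδ] with y hy
    exact (key x hx y (mem_ball.1 hy)).symm
  exact SimpleGraph.ConnectedComponent.exact (hV.constant hcont hz hw)

/-- **Stage threshold.** For two points `z, w` of a Dobrushin domain `Ω` there is `ε > 0` such
that for every mesh `0 < δ < ε` a Yang–Baxter walk of `Ω_δ` joins a side of the face of `z/δ` to
a side of the face of `w/δ`. [folklore] -/
theorem exists_threshold (hΘ : ∀ k, colShift Θ k = 1) (D : DobrushinDomain) {z w : ℂ}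
    (hz : z ∈ D.carrier) (hw : w ∈ D.carrier) :
    ∃ ε : ℝ, 0 < ε ∧ ∀ δ : ℝ, 0 < δ → δ < ε → ∃ a b : MidEdge,
      (∃ s, Face.side (⌊(z / δ).re⌋, ⌊(z / δ).im + 1 / 2⌋) s = a) ∧
      (∃ s, Face.side (⌊(w / δ).re⌋, ⌊(w / δ).im + 1 / 2⌋) s = b) ∧
        Nonempty (YangBaxterSAW Θ D.carrier δ a b) := by
  have hK : ({z, w} : Set ℂ) ⊆ D.carrier := by
    intro x hx
    simp only [Set.mem_insert_iff, Set.mem_singleton_iff] at hx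
    rcases hx with rfl | rfl
    exacts [hz, hw]
  obtain ⟨V, -, hVc, hKV, -, ρ, hρ, hVρ⟩ :=
    Literature.Probability.LatticeModels.exists_isOpen_isPreconnected_bulk D.isOpen D.isConnected
      (Set.nonempty_compl.2 D.toJordanDomain.carrier_ne_univ) (Set.toFinite {z, w}).isCompact hK
  have hVΩ : ∀ x ∈ V, ball x ρ ⊆ D.carrier := fun x hx =>
    (ball_subset_ball (hVρ x hx).le).trans ball_infDist_compl_subset
  have hzV : z ∈ V := hKV (by simp)
  have hwV : w ∈ V := hKV (by simp)
  refine ⟨ρ / 5, by positivity, fun δ hδ hδε => ?_⟩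
  have hδρ : 5 * δ ≤ ρ := by linarith
  exact stub_compassEndpoints_faceChains _ _ _ (reachable_of_mem hΘ hVc hVΩ hδ hδρ hzV hwV)
    (mem_meshFaces_of_dist_lt hΘ hδ hδρ (hVΩ z hzV)
      ((dist_planeCorner_floor_lt hΘ _).trans (by norm_num)))

/-! ### Endpoints: distance to the marked points and the limit -/

/-- A side of the face of `z/δ`, rescaled by `δ`, is within `4δ` of `z`. [folklore] -/
theorem dist_mul_planeMidpoint_le (hΘ : ∀ k, colShift Θ k = 1) {δ : ℝ} (hδ : 0 < δ) {z : ℂ}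
    {a : MidEdge} (ha : ∃ s, Face.side (⌊(z / δ).re⌋, ⌊(z / δ).im + 1 / 2⌋) s = a) :
    dist ((δ : ℂ) * planeMidpoint Θ a) z ≤ 4 * δ := by
  obtain ⟨s, rfl⟩ := ha
  set f : Face := (⌊(z / δ).re⌋, ⌊(z / δ).im + 1 / 2⌋)
  have h1 : dist (planeMidpoint Θ (f.side s)) (planeCorner Θ f) ≤ 2 :=
    rhombus_subset_closedBall hΘ _ (planeMidpoint_side_mem_rhombus Θ _ s)
  have h2 : dist (planeCorner Θ f) (z / δ) < 2 := dist_planeCorner_floor_lt hΘ (z / δ)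
  have h3 : dist (planeMidpoint Θ (f.side s)) (z / δ) ≤ 4 := by
    linarith [dist_triangle (planeMidpoint Θ (f.side s)) (planeCorner Θ f) (z / δ)]
  rw [dist_eq_norm, norm_mul_sub_eq hδ, ← dist_eq_norm]
  nlinarith

/-- If `u δ` is within `4δ` of `z (N δ)`, `z n → p` at rate `1/(n+1)` and `N δ → ∞` as
`δ → 0⁺`, then `u δ → p` as `δ → 0⁺`. [folklore] -/
theorem tendsto_of_dist_le {u : ℝ → ℂ} {z : ℕ → ℂ} {p : ℂ} {N : ℝ → ℕ}
    (hu : ∀ δ, 0 < δ → dist (u δ) (z (N δ)) ≤ 4 * δ)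
    (hz : ∀ n, dist (z n) p < 1 / ((n : ℝ) + 1)) (hN : Tendsto N (𝓝[>] (0 : ℝ)) atTop) :
    Tendsto u (𝓝[>] (0 : ℝ)) (𝓝 p) := by
  rw [Metric.tendsto_nhds]
  intro ε hε
  obtain ⟨n₀, hn₀⟩ := exists_nat_one_div_lt (half_pos hε)
  filter_upwards [Ioo_mem_nhdsGT (show (0 : ℝ) < ε / 8 by positivity),
    hN.eventually (eventually_ge_atTop n₀)] with δ hδ hNδ
  have h1 := hu δ hδ.1
  have h2 : dist (z (N δ)) p < ε / 2 := by
    refine (hz (N δ)).trans_le ((one_div_le_one_div_of_le (by positivity) ?_).trans hn₀.le)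
    have : (n₀ : ℝ) ≤ N δ := by exact_mod_cast hNδ
    linarith
  calc dist (u δ) p ≤ dist (u δ) (z (N δ)) + dist (z (N δ)) p := dist_triangle _ _ _
    _ < ε := by linarith [hδ.2]

end Endpoints

open Endpoints in
/-- **Compass endpoints** (item stmt-CriticalPhenomena-6968, the stub `stub_compassEndpoints` of
the line `Sketch` for the crux `HexTransfer`, stmt-CriticalPhenomena-14221): every Dobrushin domain
`(Ω; a, b)` admits port endpoint approximations on the square tiling `Θ ≡ π/2` — mid-edges
`a_δ, b_δ` joined by a Yang–Baxter walk of `meshFaces (π/2) Ω δ` for all small `δ > 0`, with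
`δ · a_δ → a` and `δ · b_δ → b`. Interior points `z_n → a`, `w_n → b`; at stage `n`, for `δ`
below a threshold, the faces of `z_n/δ`, `w_n/δ` are joined by a chain of faces of `Ω_δ`
(`Endpoints.exists_threshold`), which carries a Yang–Baxter walk between sides of its end faces;
a diagonal stage selection `n = N δ → ∞` (`exists_stage_tendsto_atTop`) finishes. [folklore] -/
theorem stub_compassEndpoints : SAWCompassLattice.CompassEndpoints := by
  intro D
  classical
  -- interior points `z i n → D.pt i`
  have hz : ∀ (i : Fin 2) (n : ℕ), ∃ z ∈ D.carrier, dist z (D.pt i) < 1 / ((n : ℝ) + 1) := by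
    intro i n
    obtain ⟨z, hz, hd⟩ := Metric.mem_closure_iff.1
      (frontier_subset_closure (D.pt_mem_frontier i)) (1 / ((n : ℝ) + 1)) (by positivity)
    exact ⟨z, hz, by rwa [dist_comm]⟩
  choose z hzΩ hzd using hz
  -- stage thresholds
  have hst := fun n => exists_threshold colShift_sq D (hzΩ 0 n) (hzΩ 1 n)
  choose ε hε hgood using hst
  -- endpoints at every stage and mesh (sides of the faces of `z 0 n / δ`, `z 1 n / δ`)
  have hab : ∀ (n : ℕ) (δ : ℝ), ∃ a b : MidEdge,
      (∃ s, Face.side (⌊(z 0 n / δ).re⌋, ⌊(z 0 n / δ).im + 1 / 2⌋) s = a) ∧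
      (∃ s, Face.side (⌊(z 1 n / δ).re⌋, ⌊(z 1 n / δ).im + 1 / 2⌋) s = b) ∧
      (0 < δ → δ < ε n →
        Nonempty (YangBaxterSAW (fun (_ : ℤ) => Real.pi / 2) D.carrier δ a b)) := by
    intro n δ
    by_cases h : 0 < δ ∧ δ < ε n
    · obtain ⟨a, b, ha, hb, hw⟩ := hgood n δ h.1 h.2
      exact ⟨a, b, ha, hb, fun _ _ => hw⟩
    · exact ⟨_, _, ⟨.W, rfl⟩, ⟨.W, rfl⟩, fun h₁ h₂ => absurd ⟨h₁, h₂⟩ h⟩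
  choose a b ha hb hwalk using hab
  -- diagonal stage selection
  obtain ⟨N, hN, hNtop⟩ := exists_stage_tendsto_atTop (p := fun n δ => 0 < δ ∧ δ < ε n)
    (ε := ε) hε (fun n δ h₁ h₂ => ⟨h₁, h₂⟩)
  refine ⟨fun δ => a (N δ) δ, fun δ => b (N δ) δ, ?_, ?_, ?_⟩
  · filter_upwards [hN] with δ hδ using hwalk _ δ hδ.1 hδ.2
  · exact tendsto_of_dist_le
      (fun δ hδ => dist_mul_planeMidpoint_le colShift_sq hδ (ha (N δ) δ)) (hzd 0) hNtop
  · exact tendsto_of_dist_le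
      (fun δ hδ => dist_mul_planeMidpoint_le colShift_sq hδ (hb (N δ) δ)) (hzd 1) hNtop

end Summit.CriticalPhenomena.SAWScalingLimit.Cruxes.HexTransfer.Sketch
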